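import Summits.BirchSwinnertonDyer.BirchSwinnertonDyer.Theorems.ManinLocalTwoThreeUDCLineAtNine
import Summits.BirchSwinnertonDyer.BirchSwinnertonDyer.Theorems.ManinLocalTwoThreeKummerCoverSubgroup
import Summits.BirchSwinnertonDyer.BirchSwinnertonDyer.Theorems.ManinLocalTwoThreeShimuraKernelRealStructure
import Summits.BirchSwinnertonDyer.Rank1Residual.ManinAdditive.UDCKummerLineK
import Summits.BirchSwinnertonDyer.Rank1Residual.ManinAdditive.UDCKummerLineHolds
import Summits.BirchSwinnertonDyer.Rank1Residual.ManinAdditive.CuspidalKummerCubeLaws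
import Literature.NumberTheory.EllipticCurves.ManinConstantGamma1Gamma0Comparison
import HarnessLib

/-!
# The `K`-rational Kummer/UDC line of RES₃♭ — Theorems-side compositions BY NAME (-an g39's PART B/C, landed by the C3 LEAD p1 g16)
(route `ManinLocalTwoThree`, crux C3 `ManinPrimeToThreeAtNine` stmt-BirchSwinnertonDyer-22968; cell bsd-f2-manin; `--supports stmt-BirchSwinnertonDyer-22968`)

LANDING NOTE (lead p1 g16).  SOURCE = HOME/an/g39/ManinLocalTwoThreeUDCLineKAtNine-an-g39.lean sha16 9e08cad26e62d816 (-an g39: farm rc 0 · 0 warn ·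
0 sorry, std axioms; ref1 audit R-an-75 requested by -an).  That scratch file INLINED PART A (the statement layer, now the tree module
`Summits/BirchSwinnertonDyer/Rank1Residual/ManinAdditive/UDCKummerLineK.lean`, ty g21 T-an-47) followed by PART B/C; this file is PART B/C VERBATIM
(namespace `Summit.BirchSwinnertonDyer.BirchSwinnertonDyer.Theorems.ManinLocalTwoThree`) with the inlined PART A replaced by
`import …ManinAdditive.UDCKummerLineK`, exactly as -an's header prescribes.  Companions already in the tree (lead p1 g16): EXISTC
`KummerCover.exists_shortThreeTorsionC_lift` (p735052, `…ReducibleThreeTorsionLiftC.lean`) and GENΣ on the real locus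
`KummerCover.exists_mem_gamma1_not_kummerPeriodTrivial_of_real` (p734511, `…KummerCoverNotGammaOneReal.lean`); their by-name wrappers land separately.

CONTENT (an g39, MEMO-an §82).  RES₃♭ `NoRationalThreeTorsionCoprimeIsolatedResidual` (the last non-printed stub of the C3 skeleton v28) SPLITS as
RES₃♭ ⟸ EXISTC ∧ GENΣ ∧ KLINE ∧ RESΣ (`UDCKummerLineK.noRationalThreeTorsionCoprimeIsolatedResidual_of_kLine`, PART A).  PROVED here (kernel,
no sorry): (NCΣ) `kummerCoverNoncongruenceOfNotShimura_holds` (NC-a `kummerCoverSubgroup_holds` p725557 + Kurth–Long `typeIINoncongruence_holds` +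
Wohlfahrt glue `Γ(MN) ≤ Γ₀(N) ∩ Γ(M)`); KLINE ⟹ KLINE♮ (`exists_isParamGerm`); the edges `noRationalThreeTorsionCoprimeIsolatedResidual_of_kPieces`
(EXISTC → GENΣ → (BI)_K → (AN)_K → RESΣ → RES₃♭) and `…_of_kPieces_udc` ((AN)_K ⟸ (AN♮)_K ∧ ∀ k, UDW-algInt k); PART C: (DICTΣ)
`kummerShimuraLattice_holds` (KummerShimura ⟹ Λ₁(f) ⊆ ℤ·(3u/c) + 3Λ₀(f)), `periodLatticeGamma1_ne_of_subset_line`, the GENΣ edge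
`kummerNotShimuraOfGeneric_of_muType : ShimuraKernelMuTypeAtNine → KummerNotShimuraOfGeneric` and
`noRationalThreeTorsionCoprimeIsolatedResidual_of_kPieces_muType : EXISTC → E-an-201 → (BI)_K → (AN)_K → RESΣ → RES₃♭`.
HONEST FRAMING.  CONDITIONAL reductions + unconditional lattice lemmas; RES₃♭, C3, Manin's conjecture and BSD are NOT proved; E-an-201 (Ling–Oesterlé
μ-type shadow), (BI)_K, (AN)_K and RESΣ (the Stevens fragment at additive 3) are OPEN inputs.  No definitions, no sorry.
[cite: Vatsal2005, §1 Rem. 1.8 and Conj. 1.9] [cite: LingOesterle1991, Thm. 1] [cite: KurthLong2008, Prop. 18] [cite: Stevens1989, §2, Thm. 2.3]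
-/

set_option autoImplicit false
-- lint-debt: the directory name repeats the summit name (sibling precedent `ManinLocalTwoThreeUDCLineAtNine.lean`)
set_option linter.dupNamespace false

noncomputable section

open scoped Classical MatrixGroups ModularForm PeriodPair UpperHalfPlane Manifold
open PowerSeries CongruenceSubgroup Complex
open WeierstrassCurve Literature.NumberTheory.EllipticCurves Literature.NumberTheory.EllipticCurves.ModularForms
open Summit.BirchSwinnertonDyer.Rank1Residual.ManinAdditive.CuspidalKummer
open Summit.BirchSwinnertonDyer.Rank1Residual.ManinAdditive.CuspidalKummerThree
open Summit.BirchSwinnertonDyer.Rank1Residual.ManinAdditive.UDCKummerLine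

namespace Summit.BirchSwinnertonDyer.BirchSwinnertonDyer.Theorems.ManinLocalTwoThree

open Summit.BirchSwinnertonDyer.Rank1Residual.ManinAdditive.UDCKummerLineK

/-- **(NCΣ) PROVED: `KummerCoverNoncongruenceOfNotShimura`** from NC-a (`kummerCoverSubgroup_holds`), Kurth–Long type II
(`typeIINoncongruence_holds`) and Wohlfahrt's `Γ(MN) ≤ Γ₀(N) ∩ Γ(M)` (pattern of `kummerCoverNoncongruence_nine_of_pieces`). [folklore] -/
theorem kummerCoverNoncongruenceOfNotShimura_holds : KummerCoverNoncongruenceOfNotShimura := by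
  intro W _ _ N _ D hopt u hu h3u hS M hM
  obtain ⟨Γ, hmem, hle, hfi, hnorm, htr⟩ := kummerCoverSubgroup_holds W D hopt u hu h3u
  have hnot1 : ¬ (Gamma1 N ≤ Γ) := fun hle1 ↦ hS fun γ hγ ↦ (hmem γ).mp (hle1 hγ)
  have hN : 0 < N := Nat.pos_of_ne_zero (NeZero.ne N)
  have hMN : 0 < M * N := Nat.mul_pos hM hN
  have hnotM := typeIINoncongruence_holds N hN Γ hfi hle hnorm htr hnot1 (M * N) hMN
  obtain ⟨g, hgM, hgΓ⟩ : ∃ g ∈ CongruenceSubgroup.Gamma (M * N), g ∉ Γ := by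
    by_contra h
    push Not at h
    exact hnotM h
  have hg0 : g ∈ Gamma0 N := Gamma_le_Gamma0 N (Gamma_mul_le_right M N hgM)
  exact ⟨⟨g, hg0⟩, Gamma_mul_le_left M N hgM, fun hK ↦ hgΓ ((hmem ⟨g, hg0⟩).mpr hK)⟩

/-- **KLINE ⟹ KLINE♮ (PROVED; `aₙ := aₙ(W)` via `IsNewformOf`, germ by `exists_isParamGerm`).** [folklore] -/
theorem nonShimuraThreeTorsionCaseAtNineGermFree_of_kLine (hK : NonShimuraThreeTorsionCaseAtNine) :
    NonShimuraThreeTorsionCaseAtNineGermFree := by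
  intro W _ _ N _ D h9 hL X₀ Y₀ hT u hu₁ hu₂ hX hY hS
  have h9' : 9 ∣ N := by simpa using h9
  set a : ℕ → ℤ := fun n ↦ W.LFunction n with ha_def
  have ha : ∀ n, (a n : ℂ) = cuspCoeff D.f n := fun n ↦ (D.isNewformOf.2 n).symm
  obtain ⟨z, hz⟩ := exists_isParamGerm W D.c a
  exact hK W D a ha h9' hL X₀ Y₀ hT u hu₁ hu₂ hX hY hS z hz

/-- **KLINE♮ from the tree + (BI)_K + (AN)_K (PROVED edge).** [folklore] -/
theorem nonShimuraThreeTorsionCaseAtNineGermFree_of_pieces (hBI : KummerCubeRootThreeBoundedK)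
    (hAN : KummerCubeRootCongruenceOfBoundedK) : NonShimuraThreeTorsionCaseAtNineGermFree :=
  nonShimuraThreeTorsionCaseAtNineGermFree_of_kLine
    (nonShimuraThreeTorsionCaseAtNine_of_pieces kummerCoverNoncongruenceOfNotShimura_holds hBI hAN)

/-- **RES₃♭ BY NAME from the `K`-pieces (PROVED edge): EXISTC → GENΣ → (BI)_K → (AN)_K → RESΣ → RES₃♭.**  The v26 stub swap offered to the
C3 LEAD (L-an-g39-1): replace stub 7 `stub_noRationalThreeTorsionCoprimeIsolatedResidual` by the five named pieces, of which (BI)_K/(AN)_K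
re-use the B-line witness theorems (HOLB/INVB/INV/EXT are `u`-only) and RESΣ is the honest residual (Stevens fragment ∧ `3 ∤ c₁`). [folklore] -/
theorem noRationalThreeTorsionCoprimeIsolatedResidual_of_kPieces (hEX : ReducibleShortThreeTorsionLiftC)
    (hGEN : KummerNotShimuraOfGeneric) (hBI : KummerCubeRootThreeBoundedK) (hAN : KummerCubeRootCongruenceOfBoundedK)
    (hRES : ShimuraMuThreeCaseAtNine) : NoRationalThreeTorsionCoprimeIsolatedResidual :=
  noRationalThreeTorsionCoprimeIsolatedResidual_of_kLine hEX hGEN (nonShimuraThreeTorsionCaseAtNineGermFree_of_pieces hBI hAN) hRES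

/-- **Same, with (AN)_K fed by UDC with algebraic-integer coefficients.** [folklore] -/
theorem noRationalThreeTorsionCoprimeIsolatedResidual_of_kPieces_udc (hEX : ReducibleShortThreeTorsionLiftC)
    (hGEN : KummerNotShimuraOfGeneric) (hBI : KummerCubeRootThreeBoundedK) (hANofUDC : KummerCubeRootCongruenceOfBoundedKOfUDC)
    (hUDW : ∀ k : ℤ, UnboundedDenominatorsWeightAlgInt k)
    (hRES : ShimuraMuThreeCaseAtNine) : NoRationalThreeTorsionCoprimeIsolatedResidual :=
  noRationalThreeTorsionCoprimeIsolatedResidual_of_kPieces hEX hGEN hBI (hANofUDC hUDW) hRES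

/-! ## PART C — (DICTΣ) PROVED and the GENΣ edge `ShimuraKernelMuTypeAtNine → KummerNotShimuraOfGeneric` (an g39)

Lattice algebra only (`AddSubgroup.closure_le`, `𝔽₃`-coordinates on the rank-2 Néron lattice via
`PeriodPair.intCast_pair_eq_zero`, `℘'` odd and `Λ`-periodic).  After this part GENΣ rests on the printed `μ`-type law alone. -/

section PartC

variable {W : WeierstrassCurve ℚ} [W.IsElliptic] [W.IsGloballyMinimal] {N : ℕ} [NeZero N]

omit [W.IsElliptic] [W.IsGloballyMinimal] in
/-- `c ≠ 0` for a lattice-optimal datum (`ω₁ = c·w` and `ω₁ ≠ 0`). [folklore] -/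
theorem cast_c_ne_zero_of_latticeOptimal (D : ModularParametrizationData W N)
    (hopt : ∀ z ∈ D.L.lattice, ∃ w ∈ periodLattice D.f, z = D.c * w) : (D.c : ℂ) ≠ 0 := by
  intro hc
  obtain ⟨w, -, hw⟩ := hopt D.L.ω₁ D.L.ω₁_mem_lattice
  rw [hc, zero_mul] at hw
  have h := PeriodPair.intCast_pair_eq_zero D.L (s := 1) (t := 0) (by push_cast; rw [hw]; ring)
  exact one_ne_zero h.1

omit [W.IsElliptic] [W.IsGloballyMinimal] in
/-- `3u/c ∈ Λ₀(f)` when `3u ∈ Λ_E = c·Λ₀(f)`. [folklore] -/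
theorem three_mul_div_mem_periodLattice (D : ModularParametrizationData W N)
    (hopt : ∀ z ∈ D.L.lattice, ∃ w ∈ periodLattice D.f, z = D.c * w) {u : ℂ} (hu₂ : 3 * u ∈ D.L.lattice) :
    3 * u / (D.c : ℂ) ∈ periodLattice D.f := by
  have hc := cast_c_ne_zero_of_latticeOptimal D hopt
  obtain ⟨w, hw, h⟩ := hopt _ hu₂
  have : 3 * u / (D.c : ℂ) = w := by rw [h]; field_simp
  rwa [this]

/-- **(DICTΣ) PROVED: `KummerShimuraLattice`.**  `Λ₁(f)` is the closure of the `Γ₁(N)`-cusp symbols, each of which lies in the subgroup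
`{w | ∃ k v, w = k·(3u/c) + 3v, v ∈ Λ₀(f)}` by `KummerPeriodTrivial` and `Λ_E = c·Λ₀(f)`. [folklore] -/
theorem kummerShimuraLattice_holds : KummerShimuraLattice := by
  intro W _ _ N _ D hopt u hu₁ hu₂ hS w hw
  have hc := cast_c_ne_zero_of_latticeOptimal D hopt
  let G : AddSubgroup ℂ :=
    { carrier := {w | ∃ k : ℤ, ∃ v ∈ periodLattice D.f, w = k * (3 * u / D.c) + 3 * v}
      zero_mem' := ⟨0, 0, zero_mem _, by simp⟩
      add_mem' := by
        rintro _ _ ⟨k, v, hv, rfl⟩ ⟨k', v', hv', rfl⟩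
        exact ⟨k + k', v + v', add_mem hv hv', by push_cast; ring⟩
      neg_mem' := by
        rintro _ ⟨k, v, hv, rfl⟩
        exact ⟨-k, -v, neg_mem hv, by push_cast; ring⟩ }
  suffices h : periodLatticeGamma1 D.f ≤ G from h hw
  change AddSubgroup.closure _ ≤ G
  refine (AddSubgroup.closure_le G).mpr ?_
  rintro _ ⟨γ, rfl⟩
  obtain ⟨k, ν, hν, hk⟩ := hS ⟨(γ : SL(2, ℤ)), Gamma1_in_Gamma0 N γ.2⟩ γ.2
  obtain ⟨v, hv, hνv⟩ := hopt ν hν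
  refine ⟨k, v, hv, ?_⟩
  rw [hνv] at hk
  field_simp
  linear_combination hk

omit [W.IsElliptic] [W.IsGloballyMinimal] in
/-- STEP 1 of the GENΣ edge: if `Λ₁(f) ⊆ ℤ·(3u/c) + 3Λ₀(f)` for a lift `u ∉ Λ_E`, `3u ∈ Λ_E`, then `Λ₁(f) ≠ Λ₀(f)` (a rank-`2` lattice is
not cyclic modulo `3`). [folklore] -/
theorem periodLatticeGamma1_ne_of_subset_line (D : ModularParametrizationData W N)
    (hopt : ∀ z ∈ D.L.lattice, ∃ w ∈ periodLattice D.f, z = D.c * w) {u : ℂ}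
    (hu₂ : 3 * u ∈ D.L.lattice)
    (hline : ∀ w ∈ periodLatticeGamma1 D.f, ∃ k : ℤ, ∃ v ∈ periodLattice D.f, w = k * (3 * u / D.c) + 3 * v) :
    periodLatticeGamma1 D.f ≠ periodLattice D.f := by
  intro heq
  have hc := cast_c_ne_zero_of_latticeOptimal D hopt
  have hE : ∀ z ∈ D.L.lattice, ∃ k : ℤ, ∃ ℓ ∈ D.L.lattice, z = k * (3 * u) + 3 * ℓ := by
    intro z hz
    obtain ⟨w, hw, rfl⟩ := hopt z hz
    rw [← heq] at hw
    obtain ⟨k, v, hv, rfl⟩ := hline w hw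
    refine ⟨k, D.c * v, D.smul_periodLattice_le v hv, ?_⟩
    field_simp
  obtain ⟨a, b, hab⟩ := PeriodPair.mem_lattice.mp hu₂
  obtain ⟨k₁, ℓ₁, hℓ₁, h₁⟩ := hE _ D.L.ω₁_mem_lattice
  obtain ⟨k₂, ℓ₂, hℓ₂, h₂⟩ := hE _ D.L.ω₂_mem_lattice
  obtain ⟨m₁, n₁, hmn₁⟩ := PeriodPair.mem_lattice.mp hℓ₁
  obtain ⟨m₂, n₂, hmn₂⟩ := PeriodPair.mem_lattice.mp hℓ₂
  have e₁ := PeriodPair.intCast_pair_eq_zero D.L (s := k₁ * a + 3 * m₁ - 1) (t := k₁ * b + 3 * n₁)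
    (by push_cast; linear_combination (k₁ : ℂ) * hab + 3 * hmn₁ - h₁)
  have e₂ := PeriodPair.intCast_pair_eq_zero D.L (s := k₂ * a + 3 * m₂) (t := k₂ * b + 3 * n₂ - 1)
    (by push_cast; linear_combination (k₂ : ℂ) * hab + 3 * hmn₂ - h₂)
  obtain ⟨g₁, g₂⟩ := e₁
  obtain ⟨g₃, g₄⟩ := e₂
  have h31 : (3 : ℤ) ∣ 1 := ⟨m₁ + n₂ - 3 * m₁ * n₂ + 3 * n₁ * m₂, by
    linear_combination (3 * n₂ - 1) * g₁ - (k₁ * a) * g₄ + (k₁ * b) * g₃ - (3 * m₂) * g₂⟩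
  exact absurd h31 (by decide)

/-- **GENΣ edge (PROVED): `ShimuraKernelMuTypeAtNine → KummerNotShimuraOfGeneric`.**  If every `Γ₁(N)`-Kummer period of the lift `u`
were trivial, (DICTΣ) gives `Λ₁(f) ⊆ ℤ·(3u/c) + 3Λ₀(f)`, so `Λ₁ ≠ Λ₀` (STEP 1); a kernel generator `w ∈ Λ₁ ∖ 3Λ₀` (the `μ`-type law's
first clause) has `w = k·(3u/c) + 3v` with `3 ∤ k`, whence `c·w/3 ≡ ±u (mod Λ_E)` and
`Y₀² = (c³℘'(u)/2)² = (c³℘'(cw/3)/2)² = −3r²` by the law's second clause — so `T` IS of `μ₃`-type. [folklore] -/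
theorem kummerNotShimuraOfGeneric_of_muType (hMU : ShimuraKernelMuTypeAtNine) : KummerNotShimuraOfGeneric := by
  intro W _ _ N _ D hopt h9 X₀ Y₀ hT hYirr hμ u hu₁ hu₂ hX hY hS
  have hc := cast_c_ne_zero_of_latticeOptimal D hopt
  have hline := kummerShimuraLattice_holds W D hopt u hu₁ hu₂ hS
  have hne := periodLatticeGamma1_ne_of_subset_line D hopt hu₂ hline
  obtain ⟨⟨w, hw, hw3⟩, hall⟩ := hMU W D hopt h9 hne
  obtain ⟨X, r, -, hr⟩ := hall w hw hw3
  obtain ⟨k, v, hv, hwk⟩ := hline w hw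
  have hk3 : ¬ (3 : ℤ) ∣ k := by
    rintro ⟨j, rfl⟩
    apply hw3
    refine ⟨j * (3 * u / D.c) + v, add_mem ?_ hv, ?_⟩
    · have h3uc := three_mul_div_mem_periodLattice D hopt hu₂
      simpa [zsmul_eq_mul] using (periodLattice D.f).zsmul_mem h3uc j
    · rw [hwk]; push_cast; ring
  have hcv : (D.c : ℂ) * v ∈ D.L.lattice := D.smul_periodLattice_le v hv
  have hP : (D.c : ℂ) * w / 3 = k * u + D.c * v := by
    rw [hwk]; field_simp
  have hsq : ((D.c : ℂ) ^ 3 * D.L.derivWeierstrassP ((D.c : ℂ) * w / 3) / 2) ^ 2 = Y₀ ^ 2 := by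
    obtain hk | hk : k % 3 = 1 ∨ k % 3 = 2 := by omega
    · have hq : k = 3 * (k / 3) + 1 := by omega
      have hmem : ((k / 3 : ℤ) : ℂ) * (3 * u) + D.c * v ∈ D.L.lattice :=
        add_mem (by simpa [zsmul_eq_mul] using D.L.lattice.smul_mem (k / 3) hu₂) hcv
      have harg : (D.c : ℂ) * w / 3 = u + (((k / 3 : ℤ) : ℂ) * (3 * u) + D.c * v) := by
        rw [hP]; nth_rw 1 [hq]; push_cast; ring
      have hper := D.L.derivWeierstrassP_add_coe u ⟨_, hmem⟩
      rw [harg, hper, ← hY]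
    · have hq : k = 3 * (k / 3) + 2 := by omega
      have hmem : (((k / 3 : ℤ) : ℂ) + 1) * (3 * u) + D.c * v ∈ D.L.lattice := by
        refine add_mem ?_ hcv
        simpa [zsmul_eq_mul] using D.L.lattice.smul_mem (k / 3 + 1) hu₂
      have harg : (D.c : ℂ) * w / 3 = -u + ((((k / 3 : ℤ) : ℂ) + 1) * (3 * u) + D.c * v) := by
        rw [hP]; nth_rw 1 [hq]; push_cast; ring
      have hper := D.L.derivWeierstrassP_add_coe (-u) ⟨_, hmem⟩
      rw [harg, hper, PeriodPair.derivWeierstrassP_neg, ← hY]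
      ring
  exact hμ ⟨r, by rw [← hsq]; exact hr⟩

/-- **GENΣ by name from the `μ`-type law** (DICTΣ discharged): `RES₃♭ ⟸ EXISTC ∧ E-an-201 ∧ (BI)_K ∧ (AN)_K ∧ RESΣ`. [folklore] -/
theorem noRationalThreeTorsionCoprimeIsolatedResidual_of_kPieces_muType
    (hEX : ReducibleShortThreeTorsionLiftC) (hMU : ShimuraKernelMuTypeAtNine)
    (hBI : KummerCubeRootThreeBoundedK) (hAN : KummerCubeRootCongruenceOfBoundedK)
    (hRES : ShimuraMuThreeCaseAtNine) : NoRationalThreeTorsionCoprimeIsolatedResidual :=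
  noRationalThreeTorsionCoprimeIsolatedResidual_of_kPieces hEX (kummerNotShimuraOfGeneric_of_muType hMU) hBI hAN hRES

end PartC

end Summit.BirchSwinnertonDyer.BirchSwinnertonDyer.Theorems.ManinLocalTwoThree

end
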